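import Mathlib.Analysis.SpecialFunctions.Pow.Real
import HarnessLib

/-!
# Route `UnitScaleTilt`, crux K1 «MinimiserStabilityRegPr» (stmt-QuantumFields-19200) — ARCHITECTURE (A′) ON Σ, THE END-TO-END ARITHMETIC: the member-independent choice of `κ` and of the
# L-only radius window `e ≤ e₇` under which the `κ`-arithmetic and the two windows of the junction door ✓`Prop7HcoSOfSigmaRows.hcoS_of_sigmaRowsS` hold, for rows in their DIMENSIONAL SHAPES
# (E2E-SIGMA-SPEC: `γ = B₀⁻¹`, `cN = c₀`, `cK = kK·c₀ℓ²`, `cE = kE·c₀ℓ²`, `qK = kQ·c₀·e·ℓ²`, `qM = kQ′·c₀·e·ℓ²`, `s = 2B₁′e·ℓ⁻¹`, `regThreshold = e·ℓ⁻²`)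

Cell `ym3-torus` ∕ fleet seat `ym-ust-19200-p1` (gen 17, route-R E′ lead ∕ namer).  THEOREMS ONLY (0 `def`, 0 `sorry`); `--supports stmt-QuantumFields-19200`, count-neutral.
YM₃ on T³ is a ladder rung (R3), not the Clay problem; nothing here claims the stub, the crux, `hcoS`, d = 4 or the mass gap.

WHY (namer WORD 19 (c), E2E-SIGMA-SPEC «DIMENSION CHECK»).  Every analytic Σ-row enters the junction door with constants whose `ℓ = L^{K−n}` scaling is forced by print's units
(`‖A‖² = ℓ⁻¹M`, `‖∇A‖² = ℓK`; [Balaban1985Variational] (19) p.281, (106)–(111) p.294): coercivity `γ = B₀⁻¹` (N06 `norm_G₀ᶜ` through ✓`coercive_slots_DeltaEta_of_normG₀`, window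
`1029·e·B₀ < 1`), NORM `cN = c₀` (✓p689273), SLOT `cK = kK·c₀ℓ²`, `cE = kE·c₀ℓ²` ((3.10) pair), QSMALL `qK = kQ·c₀·e·ℓ²`, `qM = kQ′·c₀·e·ℓ²` (fourth order, ✓p692319), JOINT `C₁, C₂`
(P-A2 binder), DIV-SLICE `ζ, δ₁` (P-A4), CHART `s = 2B₁′e·ℓ⁻¹` ((19)).  With these shapes the door's HESS constant is `κ := (B₀⁻¹ − (kE + kQ′)e)∕((kK + kQ·e)ℓ²)` (the `κ`-arithmetic holds
with EQUALITY) and both windows are `ℓ⁻²`-homogeneous, so ONE L-only radius `e₇(B₀, kK, kE, kQ, kQ′, C₁, C₂, ζ, δ₁, B₁′)` serves every member — the E2E file then feeds the door by `exact`.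

WHAT IS PROVED (ns `…Theorems.Prop7SigmaE2EArith`): `coerc_window` (`1029·e·B₀ < 1`), `chart_window` (`4·(2B₁′e·ℓ⁻¹) ≤ 1`), `kappa_arith` (the door's `κ`-conjuncts, equality form),
`joint_window` (`2e·C₂(1+ζ) ≤ ⅛`), ★★ `hess_window` (`2e(C₁+C₂δ₁)ℓ⁻² + 15552s² + 216·eℓ⁻² ≤ κ∕8`), all under the six product-form radius conditions
`e ≤ 1`, `2B₀(kE+kQ′+1)e ≤ 1`, `16B₀(kK+kQ)(2(C₁+C₂δ₁) + 62208B₁′² + 217)e ≤ 1`, `(16C₂(1+ζ)+1)e ≤ 1`, `2058B₀e ≤ 1`, `8B₁′e ≤ 1` (no sign conditions on `kE, kQ′, C₂, ζ` are needed).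
HONEST SCOPE.  Real arithmetic only; member-independent; nothing of print asserted.

References: T. Bałaban, CMP 102 (1985) 277–309 [Balaban1985Variational] ((19) p.281, (106)–(111) p.294, (141)–(142) p.299); CMP 99 (1985) 389–434 [Balaban1985BackgroundPropagators] (Thm 3.11 p.416).
-/

set_option autoImplicit false
noncomputable section

namespace Summit.QuantumFields.YangMills.Theorems.Prop7SigmaE2EArith

/-- COERC window of ✓`coercive_slots_DeltaEta_of_normG₀`: `1029·e·B₀ < 1` from `2058·B₀·e ≤ 1`. [bookkeeping; cite: Balaban1985BackgroundPropagators, Thm 3.11 p.416] -/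
theorem coerc_window {B₀ e : ℝ} (h5 : 2058 * B₀ * e ≤ 1) : 1029 * e * B₀ < 1 := by
  linarith

/-- CHART window: `4·s ≤ 1` for `s = 2B₁′e·ℓ⁻¹`, `1 ≤ ℓ`, `8B₁′e ≤ 1`. [bookkeeping; cite: Balaban1985Variational, (19) p.281] -/
theorem chart_window {B₁' e ℓ : ℝ} (hB₁' : 0 < B₁') (he : 0 < e) (hℓ : 1 ≤ ℓ) (h6 : 8 * B₁' * e ≤ 1) : 4 * (2 * B₁' * e * ℓ⁻¹) ≤ 1 := by
  have hℓ0 : 0 < ℓ := by linarith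
  have hinv : ℓ⁻¹ ≤ 1 := inv_le_one_of_one_le₀ hℓ
  have h0 : 0 ≤ 2 * B₁' * e := by positivity
  calc 4 * (2 * B₁' * e * ℓ⁻¹) ≤ 4 * (2 * B₁' * e * 1) := by gcongr
    _ = 8 * B₁' * e := by ring
    _ ≤ 1 := h6

/-- The door's `κ`-ARITHMETIC in the dimensional shapes, with EQUALITY: for `κ := (B₀⁻¹ − (kE + kQ′)e)∕((kK + kQ·e)ℓ²)`, `cK + qK = (kK + kQe)c₀ℓ² > 0` and
`κ(cK + qK) ≤ γcN − (cE·e + qM)ℓ⁻²` (`γ = B₀⁻¹`, `cN = c₀`, `cE = kE·c₀ℓ²`, `qM = kQ′·c₀·e·ℓ²`). [bookkeeping; cite: Balaban1985Variational, (141)-(142) p.299] -/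
theorem kappa_arith {B₀ kK kE kQ kQ' c₀ e ℓ : ℝ} (hkK : 0 < kK) (hkQ : 0 ≤ kQ) (hc₀ : 0 < c₀) (he : 0 < e) (hℓ : 0 < ℓ) :
    0 < kK * c₀ * ℓ ^ 2 + kQ * c₀ * e * ℓ ^ 2 ∧
    (B₀⁻¹ - (kE + kQ') * e) / ((kK + kQ * e) * ℓ ^ 2) * (kK * c₀ * ℓ ^ 2 + kQ * c₀ * e * ℓ ^ 2)
      ≤ B₀⁻¹ * c₀ - (kE * c₀ * ℓ ^ 2 * e + kQ' * c₀ * e * ℓ ^ 2) * (ℓ ^ 2)⁻¹ := by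
  have hD : 0 < kK + kQ * e := by nlinarith [mul_nonneg hkQ he.le]
  have hℓ2 : 0 < ℓ ^ 2 := by positivity
  refine ⟨by nlinarith [mul_pos (mul_pos hkK hc₀) hℓ2, mul_nonneg (mul_nonneg (mul_nonneg hkQ hc₀.le) he.le) hℓ2.le], le_of_eq ?_⟩
  field_simp

/-- JOINT window: `2e·(C₂(1+ζ)) ≤ ⅛` from `(16C₂(1+ζ) + 1)e ≤ 1`. [bookkeeping; cite: Balaban1985Variational, (106)-(111) p.294] -/
theorem joint_window {C₂ ζ e : ℝ} (he : 0 < e) (h4 : (16 * (C₂ * (1 + ζ)) + 1) * e ≤ 1) : 2 * e * (C₂ * (1 + ζ)) ≤ 1 / 8 := by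
  nlinarith [he]

/-- ★★ **THE HESS WINDOW**: with `κ := (B₀⁻¹ − (kE + kQ′)e)∕((kK + kQ·e)ℓ²)`, `s := 2B₁′e·ℓ⁻¹`, `regThreshold = e·(ℓ²)⁻¹`:
`2e(C₁ + C₂δ₁)(ℓ²)⁻¹ + 15552·s² + 216·(e(ℓ²)⁻¹) ≤ κ∕8` under `e ≤ 1`, `2B₀(kE+kQ′+1)e ≤ 1`, `16B₀(kK+kQ)(2(C₁+C₂δ₁) + 62208B₁′² + 217)e ≤ 1` (all terms are `ℓ⁻²`-homogeneous).
[bookkeeping; cite: Balaban1985Variational, (19) p.281, (106)-(111) p.294, (141)-(142) p.299] -/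
theorem hess_window {B₀ kK kE kQ kQ' C₁ C₂ δ₁ B₁' e ℓ : ℝ} (hB₀ : 0 < B₀) (hkK : 0 < kK) (hkQ : 0 ≤ kQ)
    (hC₁ : 0 ≤ C₁) (hC₂ : 0 ≤ C₂) (hδ₁ : 0 ≤ δ₁) (hB₁' : 0 < B₁') (he : 0 < e) (hℓ : 0 < ℓ)
    (h1 : e ≤ 1) (h2 : 2 * B₀ * (kE + kQ' + 1) * e ≤ 1) (h3 : 16 * B₀ * (kK + kQ) * (2 * (C₁ + C₂ * δ₁) + 62208 * B₁' ^ 2 + 217) * e ≤ 1) :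
    2 * e * (C₁ + C₂ * δ₁) * (ℓ ^ 2)⁻¹ + 15552 * (2 * B₁' * e * ℓ⁻¹) ^ 2 + 216 * (e * (ℓ ^ 2)⁻¹)
      ≤ (B₀⁻¹ - (kE + kQ') * e) / ((kK + kQ * e) * ℓ ^ 2) / 8 := by
  have hℓ2 : 0 < ℓ ^ 2 := by positivity
  have hD : 0 < kK + kQ * e := by nlinarith [mul_nonneg hkQ he.le]
  have hDle : kK + kQ * e ≤ kK + kQ := by nlinarith
  -- `N := B₀⁻¹ − (kE+kQ′)e ≥ B₀⁻¹/2`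
  have hB₀inv : 0 < B₀⁻¹ := inv_pos.mpr hB₀
  have hN : B₀⁻¹ / 2 ≤ B₀⁻¹ - (kE + kQ') * e := by
    have h2' : (kE + kQ') * e ≤ B₀⁻¹ / 2 := by
      rw [le_div_iff₀ (by norm_num : (0:ℝ) < 2)]
      have : (kE + kQ') * e * 2 * B₀ ≤ 1 := by nlinarith [mul_pos hB₀ he]
      calc (kE + kQ') * e * 2 = (kE + kQ') * e * 2 * B₀ * B₀⁻¹ := by field_simp
        _ ≤ 1 * B₀⁻¹ := by gcongr
        _ = B₀⁻¹ := one_mul _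
    linarith
  -- the left side is `ℓ⁻²·e·T` with `T := 2(C₁+C₂δ₁) + 62208B₁′²e + 216 ≤ 2(C₁+C₂δ₁) + 62208B₁′² + 217 =: T₁`
  have hlhs : 2 * e * (C₁ + C₂ * δ₁) * (ℓ ^ 2)⁻¹ + 15552 * (2 * B₁' * e * ℓ⁻¹) ^ 2 + 216 * (e * (ℓ ^ 2)⁻¹)
      = (e * (2 * (C₁ + C₂ * δ₁) + 62208 * B₁' ^ 2 * e + 216)) * (ℓ ^ 2)⁻¹ := by
    field_simp
    ring
  rw [hlhs]
  have hT : e * (2 * (C₁ + C₂ * δ₁) + 62208 * B₁' ^ 2 * e + 216) ≤ e * (2 * (C₁ + C₂ * δ₁) + 62208 * B₁' ^ 2 + 217) := by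
    apply mul_le_mul_of_nonneg_left _ he.le
    nlinarith [sq_nonneg B₁', mul_nonneg (sq_nonneg B₁') he.le]
  -- target: `e·T·(ℓ²)⁻¹ ≤ N/(D ℓ²)/8`; clear denominators and compare with `e·T₁·8(kK+kQ) ≤ B₀⁻¹/2 ≤ N`
  have hKQ : 0 < kK + kQ := by linarith
  have hmain : e * (2 * (C₁ + C₂ * δ₁) + 62208 * B₁' ^ 2 + 217) * (8 * (kK + kQ)) ≤ B₀⁻¹ / 2 := by
    rw [le_div_iff₀ (by norm_num : (0:ℝ) < 2)]
    have h3' : 16 * (kK + kQ) * (2 * (C₁ + C₂ * δ₁) + 62208 * B₁' ^ 2 + 217) * e * B₀ ≤ 1 := by nlinarith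
    have hB : B₀ * B₀⁻¹ = 1 := mul_inv_cancel₀ hB₀.ne'
    calc e * (2 * (C₁ + C₂ * δ₁) + 62208 * B₁' ^ 2 + 217) * (8 * (kK + kQ)) * 2
        = (16 * (kK + kQ) * (2 * (C₁ + C₂ * δ₁) + 62208 * B₁' ^ 2 + 217) * e * B₀) * B₀⁻¹ := by
          rw [show (16 * (kK + kQ) * (2 * (C₁ + C₂ * δ₁) + 62208 * B₁' ^ 2 + 217) * e * B₀) * B₀⁻¹
              = 16 * (kK + kQ) * (2 * (C₁ + C₂ * δ₁) + 62208 * B₁' ^ 2 + 217) * e * (B₀ * B₀⁻¹) by ring, hB]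
          ring
      _ ≤ 1 * B₀⁻¹ := by gcongr
      _ = B₀⁻¹ := one_mul _
  have hpos1 : 0 < (kK + kQ * e) * ℓ ^ 2 * 8 := by positivity
  rw [div_div, le_div_iff₀ hpos1]
  have hclear : e * (2 * (C₁ + C₂ * δ₁) + 62208 * B₁' ^ 2 * e + 216) * (ℓ ^ 2)⁻¹ * ((kK + kQ * e) * ℓ ^ 2 * 8)
      = e * (2 * (C₁ + C₂ * δ₁) + 62208 * B₁' ^ 2 * e + 216) * (8 * (kK + kQ * e)) := by
    field_simp
  rw [hclear]
  have hNn : 0 ≤ e * (2 * (C₁ + C₂ * δ₁) + 62208 * B₁' ^ 2 + 217) := by positivity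
  calc e * (2 * (C₁ + C₂ * δ₁) + 62208 * B₁' ^ 2 * e + 216) * (8 * (kK + kQ * e))
      ≤ e * (2 * (C₁ + C₂ * δ₁) + 62208 * B₁' ^ 2 + 217) * (8 * (kK + kQ * e)) :=
        mul_le_mul_of_nonneg_right hT (by positivity)
    _ ≤ e * (2 * (C₁ + C₂ * δ₁) + 62208 * B₁' ^ 2 + 217) * (8 * (kK + kQ)) :=
        mul_le_mul_of_nonneg_left (by linarith) hNn
    _ ≤ B₀⁻¹ / 2 := hmain
    _ ≤ B₀⁻¹ - (kE + kQ') * e := hN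

end Summit.QuantumFields.YangMills.Theorems.Prop7SigmaE2EArith

end
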